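import Literature.NumberTheory.EllipticCurves.TwoDescentLocalOdd
import HarnessLib

/-!
# Rank-2 observatory — the local conditions of the complete `2`-descent at an odd prime of
# multiplicative type `I₂ₘ` (two roots congruent modulo `p^m`, any `m ≥ 1`)

HONEST FRAMING: per-curve certified theorems and census instruments; no claim on BSD in rank ≥ 2.

The tree's `local_conditions_of_mult` (`Literature/…/TwoDescentLocalOdd.lean`, Silverman AEC X.1,
proof of Prop. X.1.4 / Example X.1.5) treats an odd prime `p` with `p ∤ (e₁ - e₂)(e₁ - e₃)` and
`v_p(e₂ - e₃) = 1` (Kodaira type `I₂`). The rank-2 census rows of the observatory need the same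
prime with `v_p(e₂ - e₃) = m ≥ 2` (type `I₂ₘ`; 3 905 prime occurrences among the 6 097 rank-2 rows
with full rational 2-torsion), where the local image of `E(ℚ_p)/2E(ℚ_p)` (order `4`) is NOT the
`m = 1` one in general. This file proves, for every rational point `(x, y)`, `y ≠ 0`, of
`y² = (x - e₁)(x - e₂)(x - e₃)` and every `m ≥ 1` (`local_conditions_of_mult_deep`):

* (I)  `v_p(x - e₁)` is even;
* (II₀) if `e₂ - e₁` is a square unit mod `p` then the unit part of `x - e₁` is a square mod `p`
        (`qrBit p (e₂ - e₁) = 0 → qrBit p (x - e₁) = 0`);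
* (II₁) if `m` is odd, `qrBit p (x - e₁) = parityBit p (x - e₂) · qrBit p (e₂ - e₁)` (the `m = 1` law);
* (II₂) if `m` is even and `e₂ - e₁` is a non-square mod `p`, then `v_p(x - e₂)` is even.

So the local image is `{v(b₁) even, χ(b₁) = 1}` when `χ(e₂ - e₁) = 1`, `{v(b₁) even, χ(b₁) = χ(e₂-e₁)^{v(b₂)}}`
when `χ(e₂ - e₁) = -1` and `m` is odd, and `{v(b₁) even, v(b₂) even}` when `χ(e₂ - e₁) = -1` and `m`
is even — two independent linear conditions in each case, as it must be (`#E(ℚ_p)[2] = 4`). The proof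
is the tree's case analysis on `v_p(x - e₁) <, =, > 0`, with one new sub-case: `v_p(x - e₁) = 0 <
v_p(x - e₂)`, where `x - e₁ ≡ e₂ - e₁`, and comparing `v_p(x - e₂)` with `m`: below `m` the factors
`x - e₂ ≡ x - e₃` have equal residues, forcing `χ(x - e₁) = 1`; above `m`, `v_p(x - e₃) = m` and the
parity of `y²` gives `v_p(x - e₂) ≡ m (mod 2)`. Only statements about RATIONAL points are made.

## References

* J. H. Silverman, *The Arithmetic of Elliptic Curves*, 2nd ed., GTM 106 (2009), Prop. X.1.4,
  Example X.1.5. [SilvermanAEC2009]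
* J. E. Cremona, *Algorithms for Modular Elliptic Curves*, 2nd ed. (1997), Sec. 3.6 (`mwrank`'s
  local images). [CremonaAlgorithms1997]
-/

noncomputable section

open scoped Classical

set_option linter.dupNamespace false

namespace Summit.BirchSwinnertonDyer.BirchSwinnertonDyer.Rank2Observatory

open Literature.NumberTheory.EllipticCurves.TwoDescentLocal
open Literature.NumberTheory.EllipticCurves.KramerTwoDescent

variable {p : ℕ} [hp : Fact p.Prime]
variable {e₁ e₂ e₃ : ℤ} {x y : ℚ}

/-- **The local conditions at an odd prime of type `I₂ₘ`.** Let `p` be an odd prime with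
`p ∤ e₁ - e₂`, `p ∤ e₁ - e₃`, `v_p(e₂ - e₃) = m ≥ 1` (`eᵢ ∈ ℤ`). For every rational point `(x, y)`,
`y ≠ 0`, of `y² = (x - e₁)(x - e₂)(x - e₃)`: (I) `v_p(x - e₁)` is even; (II₀) `qrBit p (e₂ - e₁) = 0 →
qrBit p (x - e₁) = 0`; (II₁) for odd `m`, `qrBit p (x - e₁) = parityBit p (x - e₂) · qrBit p (e₂ - e₁)`;
(II₂) for even `m` and `qrBit p (e₂ - e₁) = 1`, `parityBit p (x - e₂) = 0`.
[cite: SilvermanAEC2009, Prop. X.1.4] [cite: CremonaAlgorithms1997, Sec. 3.6] -/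
theorem local_conditions_of_mult_deep (h₁₂ : ¬ (p : ℤ) ∣ e₁ - e₂)
    (h₁₃ : ¬ (p : ℤ) ∣ e₁ - e₃) {m : ℕ} (hm : 1 ≤ m) (h₂₃ : padicValRat p ((e₂ : ℚ) - e₃) = m)
    (hy : y ≠ 0) (h : y ^ 2 = (x - e₁) * (x - e₂) * (x - e₃)) :
    Even (padicValRat p (x - e₁)) ∧
      (qrBit p ((e₂ : ℚ) - e₁) = 0 → qrBit p (x - e₁) = 0) ∧
      (¬ Even m → qrBit p (x - e₁) = parityBit p (x - e₂) * qrBit p ((e₂ : ℚ) - e₁)) ∧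
      (Even m → qrBit p ((e₂ : ℚ) - e₁) = 1 → parityBit p (x - e₂) = 0) := by
  obtain ⟨hx₁, hx₂, hx₃⟩ := factors_ne_zero hy h
  have hsum := even_sum_padicValRat (p := p) hy h
  have hbits := qrBit_add_add_eq_zero (p := p) hy h
  obtain ⟨aux3, auxc, aux1⟩ := zmod_two_aux
  have hm0 : (0 : ℤ) < m := by exact_mod_cast hm
  -- the constants
  have hv₁₂ : padicValRat p ((e₁ : ℚ) - e₂) = 0 := by
    rw [← Int.cast_sub]; exact padicValRat_intCast_eq_zero h₁₂
  have hv₁₃ : padicValRat p ((e₁ : ℚ) - e₃) = 0 := by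
    rw [← Int.cast_sub]; exact padicValRat_intCast_eq_zero h₁₃
  have hv₂₁ : padicValRat p ((e₂ : ℚ) - e₁) = 0 := by
    rw [show (e₂ : ℚ) - e₁ = -((e₁ : ℚ) - e₂) by ring, padicValRat.neg, hv₁₂]
  have hv₃₂ : padicValRat p ((e₃ : ℚ) - e₂) = m := by
    rw [show (e₃ : ℚ) - e₂ = -((e₂ : ℚ) - e₃) by ring, padicValRat.neg, h₂₃]
  have he₁₂ : (e₁ : ℚ) - e₂ ≠ 0 := by
    rw [← Int.cast_sub, Int.cast_ne_zero]; exact fun h0 => h₁₂ (h0 ▸ dvd_zero _)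
  have he₁₃ : (e₁ : ℚ) - e₃ ≠ 0 := by
    rw [← Int.cast_sub, Int.cast_ne_zero]; exact fun h0 => h₁₃ (h0 ▸ dvd_zero _)
  have he₂₁ : (e₂ : ℚ) - e₁ ≠ 0 := by rw [show (e₂ : ℚ) - e₁ = -((e₁ : ℚ) - e₂) by ring]; exact neg_ne_zero.mpr he₁₂
  have he₂₃ : (e₂ : ℚ) - e₃ ≠ 0 := by
    intro h0; rw [h0, padicValRat.zero] at h₂₃; exact absurd h₂₃.symm (by exact_mod_cast (show m ≠ 0 by omega))
  have he₃₂ : (e₃ : ℚ) - e₂ ≠ 0 := by rw [show (e₃ : ℚ) - e₂ = -((e₂ : ℚ) - e₃) by ring]; exact neg_ne_zero.mpr he₂₃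
  -- the relations between the factors
  have r₂ : x - e₂ = (x - e₁) + ((e₁ : ℚ) - e₂) := by ring
  have r₃ : x - e₃ = (x - e₁) + ((e₁ : ℚ) - e₃) := by ring
  have r₁' : x - e₁ = ((e₂ : ℚ) - e₁) + (x - e₂) := by ring
  have r₃' : x - e₃ = (x - e₂) + ((e₂ : ℚ) - e₃) := by ring
  have r₂' : x - e₂ = (x - e₃) + ((e₃ : ℚ) - e₂) := by ring
  -- packaging: from `Even v₁`, `qrBit (x - e₁) = 0`, `parityBit (x - e₂) = 0` all four follow
  have pack : Even (padicValRat p (x - e₁)) → qrBit p (x - e₁) = 0 → parityBit p (x - e₂) = 0 →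
      Even (padicValRat p (x - e₁)) ∧ (qrBit p ((e₂ : ℚ) - e₁) = 0 → qrBit p (x - e₁) = 0) ∧
      (¬ Even m → qrBit p (x - e₁) = parityBit p (x - e₂) * qrBit p ((e₂ : ℚ) - e₁)) ∧
      (Even m → qrBit p ((e₂ : ℚ) - e₁) = 1 → parityBit p (x - e₂) = 0) := fun hev hq hpar =>
    ⟨hev, fun _ => hq, fun _ => by rw [hq, hpar, zero_mul], fun _ _ => hpar⟩
  rcases lt_trichotomy (padicValRat p (x - e₁)) 0 with hneg | hzero | hpos
  · -- Case `v(x - e₁) < 0`: all three factors dominate equally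
    have d₂ := padicValRat_add_eq_left (p := p) hx₁ (b := (e₁ : ℚ) - e₂) (Or.inr (by rw [hv₁₂]; exact hneg))
    have d₃ := padicValRat_add_eq_left (p := p) hx₁ (b := (e₁ : ℚ) - e₃) (Or.inr (by rw [hv₁₃]; exact hneg))
    rw [← r₂] at d₂
    rw [← r₃] at d₃
    have heven : Even (padicValRat p (x - e₁)) := by
      rw [d₂.2, d₃.2] at hsum
      obtain ⟨k, hk⟩ := hsum
      exact ⟨k - padicValRat p (x - e₁), by omega⟩
    have q₂ : qrBit p (x - e₂) = qrBit p (x - e₁) :=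
      qrBit_congr p (by rw [r₂, res_add_of_lt p hx₁ (Or.inr (by rw [hv₁₂]; exact hneg))])
    have q₃ : qrBit p (x - e₃) = qrBit p (x - e₁) :=
      qrBit_congr p (by rw [r₃, res_add_of_lt p hx₁ (Or.inr (by rw [hv₁₃]; exact hneg))])
    rw [q₂, q₃] at hbits
    have hpar : parityBit p (x - e₂) = 0 := by rw [parityBit_eq_zero_iff, d₂.2]; exact heven
    exact pack heven (aux3 _ hbits) hpar
  · -- Case `v(x - e₁) = 0`
    have hev₁ : Even (padicValRat p (x - e₁)) := ⟨0, by rw [hzero]; rfl⟩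
    rcases lt_trichotomy (padicValRat p (x - e₂)) 0 with h2neg | h2zero | h2pos
    · -- `v(x - e₂) < 0` is impossible
      exfalso
      have d := padicValRat_add_eq_left (p := p) hx₂ (b := (e₂ : ℚ) - e₁) (Or.inr (by rw [hv₂₁]; exact h2neg))
      rw [add_comm, ← r₁'] at d
      rw [d.2] at hzero
      exact absurd hzero h2neg.ne
    · -- all three factors are units, `x - e₃ ≡ x - e₂`
      have hv₃ : padicValRat p (x - e₃) = 0 := by
        rcases lt_trichotomy (padicValRat p (x - e₃)) 0 with h3 | h3 | h3
        · exfalso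
          have d := padicValRat_add_eq_left (p := p) hx₃ (b := (e₃ : ℚ) - e₂) (Or.inr (by rw [hv₃₂]; omega))
          rw [← r₂'] at d
          rw [d.2] at h2zero
          exact absurd h2zero h3.ne
        · exact h3
        · exfalso
          have d := le_padicValRat_add_or (p := p) (a := x - e₃) (b := (e₃ : ℚ) - e₂) (c := 1)
            (Or.inr (by omega)) (Or.inr (by rw [hv₃₂]; omega))
          rw [← r₂'] at d
          rcases d with d | d
          · exact hx₂ d
          · rw [h2zero] at d; exact absurd d (by norm_num)
      have q₃ : qrBit p (x - e₃) = qrBit p (x - e₂) :=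
        qrBit_congr p (by rw [r₃', res_add_of_lt p hx₂ (Or.inr (by rw [h2zero, h₂₃]; exact hm0))])
      rw [q₃] at hbits
      have hpar : parityBit p (x - e₂) = 0 := by rw [parityBit_eq_zero_iff, h2zero]; exact ⟨0, rfl⟩
      exact pack hev₁ (auxc _ _ hbits) hpar
    · -- `x ≡ e₂ ≡ e₃ (mod p)`: `x - e₁ ≡ e₂ - e₁`; compare `v(x - e₂)` with `m`
      have q₁ : qrBit p (x - e₁) = qrBit p ((e₂ : ℚ) - e₁) :=
        qrBit_congr p (by rw [r₁', res_add_of_lt p he₂₁ (Or.inr (by rw [hv₂₁]; exact h2pos))])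
      -- if `e₂ - e₁` is a non-square then `v(x - e₂) ≥ m` and `v(x - e₂) ≡ m (mod 2)`
      have key : qrBit p ((e₂ : ℚ) - e₁) = 1 → (Even (padicValRat p (x - e₂)) ↔ Even (m : ℤ)) := by
        intro hc
        rcases lt_trichotomy (padicValRat p (x - e₂)) m with hlt | heq | hgt
        · -- below `m`: `x - e₃ ≡ x - e₂`, forcing `qrBit (x - e₁) = 0`
          exfalso
          have q₃ : qrBit p (x - e₃) = qrBit p (x - e₂) :=
            qrBit_congr p (by rw [r₃', res_add_of_lt p hx₂ (Or.inr (by rw [h₂₃]; exact hlt))])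
          rw [q₃, q₁, hc] at hbits
          exact absurd (auxc _ _ hbits) one_ne_zero
        · rw [heq]
        · -- above `m`: `v(x - e₃) = m`, and `0 + v₂ + m` is even
          have d := padicValRat_add_eq_left (p := p) he₂₃ (b := x - e₂) (Or.inr (by rw [h₂₃]; exact hgt))
          rw [add_comm, ← r₃'] at d
          rw [hzero, zero_add, d.2, h₂₃] at hsum
          exact Int.even_add.mp hsum
      refine ⟨hev₁, fun hc => by rw [q₁, hc], fun hmo => ?_, fun hme hc => ?_⟩
      · -- `m` odd
        by_cases hc : qrBit p ((e₂ : ℚ) - e₁) = 0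
        · rw [q₁, hc, mul_zero]
        · have hc1 := aux1 _ hc
          have hodd : ¬ Even (padicValRat p (x - e₂)) := fun hev =>
            hmo ((Int.even_coe_nat m).mp (((key hc1).mp hev)))
          rw [q₁, hc1, aux1 _ (fun h0 => hodd (parityBit_eq_zero_iff.mp h0)), one_mul]
      · -- `m` even
        exact parityBit_eq_zero_iff.mpr ((key hc).mpr ((Int.even_coe_nat m).mpr hme))
  · -- Case `v(x - e₁) > 0`: the other two factors are the units `e₁ - e₂ ≡ e₁ - e₃`
    have d₂ := padicValRat_add_eq_left (p := p) he₁₂ (b := x - e₁) (Or.inr (by rw [hv₁₂]; exact hpos))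
    have d₃ := padicValRat_add_eq_left (p := p) he₁₃ (b := x - e₁) (Or.inr (by rw [hv₁₃]; exact hpos))
    rw [add_comm, ← r₂] at d₂
    rw [add_comm, ← r₃] at d₃
    have heven : Even (padicValRat p (x - e₁)) := by
      rw [d₂.2, d₃.2, hv₁₂, hv₁₃, add_zero, add_zero] at hsum
      exact hsum
    have q₂ : qrBit p (x - e₂) = qrBit p ((e₁ : ℚ) - e₂) :=
      qrBit_congr p (by rw [r₂, add_comm, res_add_of_lt p he₁₂ (Or.inr (by rw [hv₁₂]; exact hpos))])
    have q₃ : qrBit p (x - e₃) = qrBit p ((e₁ : ℚ) - e₃) :=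
      qrBit_congr p (by rw [r₃, add_comm, res_add_of_lt p he₁₃ (Or.inr (by rw [hv₁₃]; exact hpos))])
    have q₂₃ : qrBit p ((e₁ : ℚ) - e₃) = qrBit p ((e₁ : ℚ) - e₂) :=
      qrBit_congr p (by
        rw [show (e₁ : ℚ) - e₃ = ((e₁ : ℚ) - e₂) + ((e₂ : ℚ) - e₃) by ring,
          res_add_of_lt p he₁₂ (Or.inr (by rw [hv₁₂, h₂₃]; exact hm0))])
    rw [q₂, q₃, q₂₃] at hbits
    have hpar : parityBit p (x - e₂) = 0 := by
      rw [parityBit_eq_zero_iff, d₂.2, hv₁₂]; exact ⟨0, rfl⟩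
    exact pack heven (auxc _ _ hbits) hpar

/-- (I) alone, type `I₂ₘ`: `v_p(x - e₁)` is even. [cite: SilvermanAEC2009, Prop. X.1.4] -/
theorem even_padicValRat_sub_of_mult_deep (h₁₂ : ¬ (p : ℤ) ∣ e₁ - e₂)
    (h₁₃ : ¬ (p : ℤ) ∣ e₁ - e₃) {m : ℕ} (hm : 1 ≤ m) (h₂₃ : padicValRat p ((e₂ : ℚ) - e₃) = m)
    (hy : y ≠ 0) (h : y ^ 2 = (x - e₁) * (x - e₂) * (x - e₃)) :
    Even (padicValRat p (x - e₁)) :=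
  (local_conditions_of_mult_deep h₁₂ h₁₃ hm h₂₃ hy h).1

/-- (II₀) alone: if `e₂ - e₁` is a square unit mod `p`, the unit part of `x - e₁` is a square mod `p`.
[cite: SilvermanAEC2009, Prop. X.1.4] -/
theorem qrBit_sub_eq_zero_of_mult_deep (h₁₂ : ¬ (p : ℤ) ∣ e₁ - e₂)
    (h₁₃ : ¬ (p : ℤ) ∣ e₁ - e₃) {m : ℕ} (hm : 1 ≤ m) (h₂₃ : padicValRat p ((e₂ : ℚ) - e₃) = m)
    (hy : y ≠ 0) (h : y ^ 2 = (x - e₁) * (x - e₂) * (x - e₃)) (hc : qrBit p ((e₂ : ℚ) - e₁) = 0) :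
    qrBit p (x - e₁) = 0 :=
  (local_conditions_of_mult_deep h₁₂ h₁₃ hm h₂₃ hy h).2.1 hc

/-- (II₁) alone, `m` odd: the `m = 1` law `qrBit p (x - e₁) = parityBit p (x - e₂) · qrBit p (e₂ - e₁)`.
[cite: SilvermanAEC2009, Prop. X.1.4] -/
theorem qrBit_sub_of_mult_deep_odd (h₁₂ : ¬ (p : ℤ) ∣ e₁ - e₂)
    (h₁₃ : ¬ (p : ℤ) ∣ e₁ - e₃) {m : ℕ} (hm : 1 ≤ m) (hmo : ¬ Even m) (h₂₃ : padicValRat p ((e₂ : ℚ) - e₃) = m)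
    (hy : y ≠ 0) (h : y ^ 2 = (x - e₁) * (x - e₂) * (x - e₃)) :
    qrBit p (x - e₁) = parityBit p (x - e₂) * qrBit p ((e₂ : ℚ) - e₁) :=
  (local_conditions_of_mult_deep h₁₂ h₁₃ hm h₂₃ hy h).2.2.1 hmo

/-- (II₂) alone, `m` even and `e₂ - e₁` a non-square mod `p`: `v_p(x - e₂)` is even.
[cite: SilvermanAEC2009, Prop. X.1.4] -/
theorem parityBit_sub_eq_zero_of_mult_deep_even (h₁₂ : ¬ (p : ℤ) ∣ e₁ - e₂)
    (h₁₃ : ¬ (p : ℤ) ∣ e₁ - e₃) {m : ℕ} (hm : 1 ≤ m) (hme : Even m) (h₂₃ : padicValRat p ((e₂ : ℚ) - e₃) = m)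
    (hy : y ≠ 0) (h : y ^ 2 = (x - e₁) * (x - e₂) * (x - e₃)) (hc : qrBit p ((e₂ : ℚ) - e₁) = 1) :
    parityBit p (x - e₂) = 0 :=
  (local_conditions_of_mult_deep h₁₂ h₁₃ hm h₂₃ hy h).2.2.2 hme hc

end Summit.BirchSwinnertonDyer.BirchSwinnertonDyer.Rank2Observatory

end
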